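import Summits.HodgeConjecture.CorCM.Census.DihedralSurfaceTripleDegrees

/-!
# The exceptional classes of `S₁ × S₂ × S₁′` as the Weil line of an abelian eightfold; CM types of the dihedral quartic field — kernel census

COR-CM (cell `pub-hodgecm2`), literature seat André-3 (portfolio pass, gen 4, 2026-08-21), count-neutral sequel to
`Census/DihedralSurfaceTriple.lean` / `…Degrees.lean`.  Finite, kernel-decided statements only (no named fact, no
geometry, no `sorry`); the DICTIONARY to geometry is cited, not formalised.  Conventions = the first file:
`D₄ = {rʲ sᶠ}`, `K₁ = F^{⟨s⟩}` with embeddings `ℤ/4` (`r : i ↦ i+1`, `s : i ↦ -i`), `K₂ = F^{⟨r³s⟩}` (`s : i ↦ 1-i`),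
`c = r²`; `S₁ = (K₁,{0,1})` (factor `0`), `S₂ = (K₂,{0,3})` (factor `1`), `S₁′ = (K₁,{1,2})` (factor `2`).

* §1 CM TYPES OF `K₁`.  The four CM types `{0,1},{1,2},{2,3},{3,0}` of the non-Galois quartic CM field `K₁` form ONE
  orbit under `Gal(F/ℚ) = D₄`; no set of two types is `D₄`-stable; the eight ordered pairs `(T,T′)` with
  `|T ∩ T′| = 1` form ONE `D₄`-orbit, and the stabiliser `⟨s⟩` of the embedding `0` SWAPS the two pairs over `0`.
  Contrast (same permutation model): under the Klein subgroup `V = {1, r², rs, r³s}`, which acts simply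
  transitively on the embeddings with `r²` = complex conjugation — the permutation model of a biquadratic CM field
  `ℚ(√t, √-q)` [cite: Markman2025SecantRealMultiplication, §12.2.1] — the types form two orbits of size `2`, two
  `2`-sets of types are stable, and the eight ordered pairs form two orbits of size `4`, each meeting every
  embedding exactly once.  DICTIONARY: for a CM field `K` with `[K:ℚ] = e = 4` Markman's secant space `B` has the
  pure spinors `ℓ_T` (one per CM type) as a `K̃`-basis permuted by `Gal(K̃/ℚ)`, `B ⊗ B = ⊕_k BB_k` with `BB_k`
  spanned by the `ℓ_T ⊗ ℓ_{T′}`, `|T ∩ T′| = k`, `dim BB₁ = e·2^{e/2-1} = 8`, and `BB₁ → HW` maps `ℓ_T ⊗ ℓ_{T′}` onto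
  the Weil eigenline `∧^d V_σ`, `{σ} = T ∩ T′` [cite: Markman2025SecantRealMultiplication, §1.1 and §11.1]; the
  device of [cite: Markman2025SecantRealMultiplication, Lemma 12.2.1] ("all but one summand `c_{T,T′}` vanish for
  each `σ`", using the rational secant planes `P_{K₀}`, `P_{K₁}` spanned by Galois-stable pairs of types) therefore
  has no analogue for `K₁`: a rational class has Galois-conjugate components on the single orbit of size `8`, so over
  each `σ` both summands vanish or neither does (cell note `HOME/pub-hodgecm2-lit-andre-3/PORTFOLIO-lit-andre-3-g4.md` §3).
* §2 THE WEIL EIGHTFOLD.  `A := S₁ × S₁′ × X₁`, `X₁ := S₂ ⊗_{𝒪_{K₂}} 𝒪_F ~ S₂²` with `F` acting, hence `K₁ ⊂ F`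
  acting on all three factors (cell note `HOME/pub-hodgecm2-b20/F9-MARKMAN-WEIL.md` §1, there with twisted
  labels).  The sixteen eigenlines of `H¹(A)` carry a `K₁`-character `i ∈ ℤ/4` and a Hodge type; the
  `K₁`-signature `(m_i)` (`m_i` = number of `(1,0)`-lines of character `i`) is `(2,2,2,2)` — WEIL TYPE, `d = 4`,
  `e = 4`, `n = de/4 = 4` [cite: Markman2025SecantRealMultiplication, §1.1 (condition `dim H^{1,0}_σ = dim H^{0,1}_σ = d/2`)] = [cite: Deligne1982, Prop. 4.4] —
  for exactly two of the eight complex-conjugation twists of the three actions (the untwisted one and its global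
  conjugate); e.g. twisting `S₁` alone gives `(1,1,3,3)`.
* §3 WEIL MONOMIALS = EXCEPTIONAL CLASSES.  `W ⊗ ℂ = ∧⁴_{K₁}H¹(A) ⊗ ℂ = ⊕_i ∧⁴(H¹_{σ_i})`; the character-`i`
  eigenspace is spanned by `e_{(0,i)}`, `e_{(2,i)}` and the two `F`-lines of `X₁` over the `K₂`-embeddings `i`,
  `i+1`; its shadow on `S₁ × S₂ × S₁′` is EXACTLY the exceptional Pohlmann set `E_i = {(0,i),(1,i),(1,i+1),(2,i)}`
  of `exceptional_eq` / `excFamily`, of type `(2,2)` and Künneth multidegree `(1,2,1)`.  This is the combinatorial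
  core of the theorem «`E` algebraic ⟺ `W` algebraic» of the b20 note (§2 there), i.e. of «F-9 ⟺ Markman's Question
  1.1 for one CM point with `(e,d,n) = (4,4,4)`» [cite: Markman2025SurveySecant, Question 1.1].
* §4 CHARACTERS.  `E_i = D_i ⊔ T_i` with `D_i = {(0,i),(2,i)}` (the `K₁`-diagonal K3-type piece
  `D ⊂ H¹(S₁) ⊗ H¹(S₁′)`: Hodge types `(1,1),(2,0),(1,1),(0,2)`) and `T_i = {(1,i),(1,i+1)}` (the transcendental
  lattice `T(S₂)`: types `(1,1),(0,2),(1,1),(2,0)`); `D` and `T(S₂)` have the SAME table of Pohlmann characters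
  `g ↦ |g·P ∩ Φ|` up to the shift `i ↦ i+2` (so they are isomorphic rational Hodge structures of K3 type, the
  Kuga–Satake / correspondence forms (IV), (IV′) of gen 3), and the two `F`-lines of `X₁` of character `i` shadow
  `T_i` (so `∧²_{K₁}H¹(X₁) ≅ T(S₂)`, the `D₁` of the b20 note).  [cite: GaoUllmo2025, Thm 3.1]

## References
* [Markman2025SecantRealMultiplication] E. Markman, Secant sheaves on abelian n-folds with real multiplication and Weil classes on abelian 2n-folds with complex multiplication, arXiv:2509.23079 (2025), §1.1, §11.1, §12.2.1 (Lemma 12.2.1, Question 12.2.2), §12.2.2.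
* [Markman2025SurveySecant] E. Markman, Secant sheaves and Weil classes on abelian varieties, arXiv:2509.23403 (2025), Question 1.1, Thm 1.2, Cor 1.3, Thm 1.4.
* [Deligne1982] P. Deligne, Hodge cycles on abelian varieties, in LNM 900 (1982), Prop. 4.4 (p. 46).
* [GaoUllmo2025] Z. Gao, E. Ullmo, J. Inst. Math. Jussieu 25 (2025) = arXiv:2411.12249, Thm 3.1 (= [Pohlmann1968, Thm 1]).

## Provenance
Kernel cost: `decide` over `D₄` (8 elements), `ℤ/4`, `Bool³` and the sixteen lines (seconds).  Oracle: exact python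
`g4/scratch/weil_line.py` in `run/shared/lean/pub/pub-hodgecm2/pub-hodgecm2-lit-andre-3/` (< 1 s).
-/

namespace Summit.HodgeConjecture.CorCM.Census.DihedralSurfaceTriple

open Finset

namespace WeilLine

/-! ## §1 CM types of `K₁` under `D₄` and under the Klein subgroup -/

/-- `D₄ = {rʲ sᶠ}` as pairs `(j, f)`. [folklore] -/
abbrev G : Type := ZMod 4 × Bool

/-- `rʲ sᶠ` on the embeddings `ℤ/4` of `K₁ = F^{⟨s⟩}` (`s : i ↦ -i`, `r : i ↦ i + 1`), = `act` on factor `0`.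
[cite: MoonenZarhin1999, section "Hodge groups of simple abelian surfaces of CM-type"] -/
def actK1 (g : G) (i : ZMod 4) : ZMod 4 := (if g.2 then -i else i) + g.1

set_option maxRecDepth 8000 in
set_option maxHeartbeats 4000000 in
/-- Sanity: `actK1` is the factor-`0` component of `act`. [folklore] -/
theorem actK1_eq_act : ∀ g : G, ∀ i : ZMod 4, act g.1 g.2 ((0 : Fin 3), i) = (0, actK1 g i) := by decide

/-- The CM types of `K₁`: `2`-subsets of `Hom(K₁, ℚ̄) = ℤ/4` containing exactly one of `i`, `c·i = i + 2`.
[cite: Markman2025SurveySecant, §1.1 ("such a pair (K,T) is called a CM-type")] -/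
def cmTypes : Finset (Finset (ZMod 4)) :=
  (univ.powersetCard 2).filter fun T => ∀ i : ZMod 4, i ∈ T ↔ i + 2 ∉ T

/-- `g · T`. [folklore] -/
def actT (g : G) (T : Finset (ZMod 4)) : Finset (ZMod 4) := T.image (actK1 g)

/-- The Klein subgroup `V = {1, r², rs, r³s}` of `D₄`: it acts simply transitively on `ℤ/4` and contains `c = r²` —
the permutation model of `Gal(ℚ(√t,√-q)/ℚ) ≅ (ℤ/2)²` acting on the four embeddings, `γ ↦ rs`, `ι ↦ r²`.
[cite: Markman2025SecantRealMultiplication, §12.2.1] -/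
def klein : Finset G := {((0 : ZMod 4), false), (2, false), (1, true), (3, true)}

set_option maxRecDepth 8000 in
set_option maxHeartbeats 4000000 in
/-- The four CM types, explicitly; `V` is a subgroup acting simply transitively; `⟨s⟩ = Stab(0)` in `D₄`.
[cite: Markman2025SecantRealMultiplication, §12.2.1] -/
theorem cmTypes_eq :
    cmTypes = { {0, 1}, {1, 2}, {2, 3}, {3, 0} } ∧
    (∀ g ∈ klein, ∀ h ∈ klein, ∃ k ∈ klein, ∀ i : ZMod 4, actK1 g (actK1 h i) = actK1 k i) ∧
    (∀ i : ZMod 4, (klein.filter fun g => actK1 g 0 = i).card = 1) ∧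
    ((univ : Finset G).filter fun g => actK1 g 0 = 0) = {((0 : ZMod 4), false), (0, true)} := by
  decide +kernel

set_option maxRecDepth 8000 in
set_option maxHeartbeats 4000000 in
/-- **Types: one `D₄`-orbit of size `4` (stabilisers of order `2`); two `V`-orbits of size `2`** — under `V` the
orbits are `{ {0,1}, {2,3} }` (the types fixed by `rs ↔ γ`) and `{ {1,2}, {3,0} }` (fixed by `r³s ↔ ιγ`), cf. "the set
`𝒯_K` consists of two `Gal(K/ℚ)`-orbits". [cite: Markman2025SecantRealMultiplication, §12.2.1] -/
theorem types_orbits :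
    (∀ T ∈ cmTypes, (univ : Finset G).image (fun g => actT g T) = cmTypes) ∧
    (∀ T ∈ cmTypes, ((univ : Finset G).filter fun g => actT g T = T).card = 2) ∧
    klein.image (fun g => actT g {0, 1}) = { {0, 1}, {2, 3} } ∧
    klein.image (fun g => actT g {1, 2}) = { {1, 2}, {3, 0} } ∧
    (cmTypes.filter fun T => actT (1, true) T = T) = { {0, 1}, {2, 3} } ∧
    (cmTypes.filter fun T => actT (3, true) T = T) = { {1, 2}, {3, 0} } := by
  decide +kernel

set_option maxRecDepth 8000 in
set_option maxHeartbeats 4000000 in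
/-- **Secant planes.** A plane `ℓ_T ⊕ ℓ_{T′} ⊂ B ⊗ K̃` is defined over `ℚ` iff `{T, T′}` is Galois-stable.  Under
`D₄` NO `2`-set of types is stable (the `{T, T̄}` pairs form an orbit of size `2`, the other four `2`-sets an orbit
of size `4`); under `V` exactly the two sets of `γ`- resp. `ιγ`-fixed types are stable (Markman's rational planes
`P_{K₀}`, `P_{K₁}` with `B = P_{K₀} ⊕ P_{K₁}`). [cite: Markman2025SecantRealMultiplication, §12.2.1] -/
theorem secantPlanes :
    ((cmTypes.powersetCard 2).filter fun S => ∀ g : G, S.image (actT g) = S) = ∅ ∧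
    (cmTypes.powersetCard 2).card = 6 ∧
    (univ : Finset G).image (fun g => ({ {0, 1}, {2, 3} } : Finset (Finset (ZMod 4))).image (actT g)) =
      { { {0, 1}, {2, 3} }, { {1, 2}, {3, 0} } } ∧
    ((univ : Finset G).image (fun g => ({ {0, 1}, {1, 2} } : Finset (Finset (ZMod 4))).image (actT g))).card = 4 ∧
    ((cmTypes.powersetCard 2).filter fun S => ∀ g ∈ klein, S.image (actT g) = S) =
      { { {0, 1}, {2, 3} }, { {1, 2}, {3, 0} } } := by
  decide +kernel

/-- Markman's grading index sets: ordered pairs of CM types with `|T ∩ T′| = k` (`BB_k ⊗ K̃ = ⊕ ℓ_T ⊗ ℓ_{T′}`).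
[cite: Markman2025SecantRealMultiplication, §11.1] -/
def bb (k : ℕ) : Finset (Finset (ZMod 4) × Finset (ZMod 4)) :=
  (cmTypes ×ˢ cmTypes).filter fun p => (p.1 ∩ p.2).card = k

/-- `g · (T, T′)`. [folklore] -/
def actP (g : G) (p : Finset (ZMod 4) × Finset (ZMod 4)) : Finset (ZMod 4) × Finset (ZMod 4) :=
  (actT g p.1, actT g p.2)

set_option maxRecDepth 8000 in
set_option maxHeartbeats 4000000 in
/-- `dim BB₀ = 4` (`T′ = T̄`), `dim BB₁ = 8 = e·2^{e/2-1}`, `dim BB₂ = 4` (`T′ = T`); `4 + 8 + 4 = 16 = dim B ⊗ B`;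
over each embedding `σ` lie exactly two pairs of `bb 1`, namely `(T, T′)` and `(T′, T)`.
[cite: Markman2025SecantRealMultiplication, §1.1 (footnote: "dim HW = 4, dim BB₁ = 8, dim B⊗B = 16")] -/
theorem bb_card :
    (bb 0).card = 4 ∧ (bb 1).card = 8 ∧ (bb 2).card = 4 ∧ (cmTypes ×ˢ cmTypes).card = 16 ∧
    (∀ p ∈ bb 0, p.2 = actT (2, false) p.1) ∧ (∀ p ∈ bb 2, p.2 = p.1) ∧
    (∀ i : ZMod 4, ((bb 1).filter fun p => p.1 ∩ p.2 = {i}).card = 2) ∧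
    (∀ p ∈ bb 1, (p.2, p.1) ∈ bb 1 ∧ p.2 ≠ p.1) := by
  decide +kernel

set_option maxRecDepth 8000 in
set_option maxHeartbeats 4000000 in
/-- **`BB₁` under `D₄`: ONE orbit of size `8`; the stabiliser `⟨s⟩` of the embedding `0` swaps the two pairs over
`0`.**  Under `V`: two orbits of size `4`, each containing exactly one pair over every embedding (the pattern that
lets [Lemma 12.2.1] choose sheaves with "precisely one non-zero term `c_{(T,T′)}`" per `σ`).
[cite: Markman2025SecantRealMultiplication, Lemma 12.2.1] -/
theorem bb1_orbits :
    (∀ p ∈ bb 1, (univ : Finset G).image (fun g => actP g p) = bb 1) ∧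
    ((bb 1).filter fun p => p.1 ∩ p.2 = {0}) = {({0, 1}, {3, 0}), ({3, 0}, {0, 1})} ∧
    actP (0, true) ({0, 1}, {3, 0}) = ({3, 0}, {0, 1}) ∧
    (∀ p ∈ bb 1, (klein.image fun g => actP g p).card = 4 ∧
      ∀ i : ZMod 4, ((klein.image fun g => actP g p).filter fun q => q.1 ∩ q.2 = {i}).card = 1) := by
  decide +kernel

/-! ## §2 The Weil eightfold `A = S₁ × S₁′ × X₁` -/

/-- The sixteen eigenlines of `H¹(A, ℚ̄)`: four of `S₁`, four of `S₁′` (indexed by `Hom(K₁, ℚ̄) = ℤ/4`) and eight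
of `X₁ = S₂ ⊗_{𝒪_{K₂}} 𝒪_F` (indexed by `Hom(F, ℚ̄) ≅ D₄`, `g ↦ ι ∘ g`). [cite: Deligne1982, §4 (p. 46, "decomposition
`H¹_B(A) ⊗ ℂ = ⊕_σ H¹_{B,σ}`")] -/
inductive Line
  | s1 (i : ZMod 4)
  | s1' (i : ZMod 4)
  | x1 (g : G)
  deriving DecidableEq, Fintype

/-- The `K₂`-embedding under a line `g` of `X₁`: `g · 0` for the `K₂`-rule (`s : i ↦ 1 - i`), i.e. the eigenline of
`H¹(S₂) ⊗_{K₂} F` for `ι ∘ g` lies over the `K₂`-eigenspace `(ι ∘ g)|_{K₂}`. [folklore] -/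
def idxK2 (g : G) : ZMod 4 := (if g.2 then 1 else 0) + g.1

set_option maxRecDepth 8000 in
set_option maxHeartbeats 4000000 in
/-- Sanity: `idxK2` is the factor-`1` component of `act` at the base embedding `0`, and `0` is fixed by
`Gal(F/K₂) = ⟨r³s⟩` (so it is the inclusion `K₂ ⊂ F`). [folklore] -/
theorem idxK2_eq_act : (∀ g : G, act g.1 g.2 ((1 : Fin 3), (0 : ZMod 4)) = (1, idxK2 g)) ∧ idxK2 (3, true) = 0 := by
  decide +kernel

/-- The `K₁`-character of a line for the action twisted by complex conjugation on the factors flagged in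
`ε = (ε_{S₁}, ε_{S₁′}, ε_{X₁})` (`K₁ ⊂ F` acts on `X₁` through `F`; the line `g` has character `(ι∘g)|_{K₁} = g·0`).
[cite: Deligne1982, §4 (p. 46)] -/
def charK1 (ε : Bool × Bool × Bool) : Line → ZMod 4
  | .s1 i => if ε.1 then i + 2 else i
  | .s1' i => if ε.2.1 then i + 2 else i
  | .x1 g => (if ε.2.2 then actK1 g 2 else actK1 g 0)

/-- Hodge type `(1,0)`? — read off the CM types `{0,1}` (`S₁`), `{1,2}` (`S₁′`), `{0,3}` (`S₂`, through `idxK2`),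
i.e. off `phi`. [cite: GaoUllmo2025, Thm 3.1] -/
def isHol : Line → Bool
  | .s1 i => decide (((0 : Fin 3), i) ∈ phi)
  | .s1' i => decide (((2 : Fin 3), i) ∈ phi)
  | .x1 g => decide (((1 : Fin 3), idxK2 g) ∈ phi)

/-- The `K₁`-signature `(m_0, m_1, m_2, m_3)`, `m_i = dim H^{1,0}_{σ_i}`. [cite: Deligne1982, Prop. 4.4 ("a_σ")] -/
def signature (ε : Bool × Bool × Bool) : List ℕ :=
  [0, 1, 2, 3].map fun i => ((univ : Finset Line).filter fun L => charK1 ε L = (i : ZMod 4) ∧ isHol L = true).card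

set_option maxRecDepth 8000 in
set_option maxHeartbeats 4000000 in
/-- **Weil type.** Each `σ_i`-eigenspace of `H¹(A)` is `4`-dimensional (`d = 4`) with `8` holomorphic lines in all
(`dim A = 8`); the signature is `(2,2,2,2)` = Weil type exactly for the untwisted action and its global conjugate;
the factor signatures are `S₁ : (1,1,0,0)`, `S₁′ : (0,1,1,0)`, `X₁ : (1,0,1,2)`; twisting `S₁` alone gives
`(1,1,3,3)` ("no Weil line"). [cite: Deligne1982, Prop. 4.4] -/
theorem signature_census :
    (∀ ε : Bool × Bool × Bool, ∀ i : ZMod 4, ((univ : Finset Line).filter fun L => charK1 ε L = i).card = 4) ∧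
    ((univ : Finset Line).filter fun L => isHol L = true).card = 8 ∧
    signature (false, false, false) = [2, 2, 2, 2] ∧
    ((univ : Finset (Bool × Bool × Bool)).filter fun ε => signature ε = [2, 2, 2, 2]) =
      {(false, false, false), (true, true, true)} ∧
    ([0, 1, 2, 3].map fun i => ((univ : Finset (ZMod 4)).filter fun j =>
        j = (i : ZMod 4) ∧ isHol (.s1 j) = true).card) = [1, 1, 0, 0] ∧
    ([0, 1, 2, 3].map fun i => ((univ : Finset (ZMod 4)).filter fun j =>
        j = (i : ZMod 4) ∧ isHol (.s1' j) = true).card) = [0, 1, 1, 0] ∧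
    ([0, 1, 2, 3].map fun i => ((univ : Finset G).filter fun g =>
        actK1 g 0 = (i : ZMod 4) ∧ isHol (.x1 g) = true).card) = [1, 0, 1, 2] ∧
    signature (true, false, false) = [1, 1, 3, 3] := by
  decide +kernel

/-! ## §3 Weil monomials are the exceptional classes -/

/-- Shadow of a line on the twelve points of `Y = S₁ × S₂ × S₁′`: an `F`-line of `X₁ ~ S₂²` is recorded by the
`K₂`-eigenline of `S₂` it lies over. [folklore] -/
def shadow : Line → Pt
  | .s1 i => (0, i)
  | .s1' i => (2, i)
  | .x1 g => (1, idxK2 g)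

/-- The `σ_i`-eigenlines of `H¹(A)` for the twist `ε`: their top wedge spans the `σ_i`-summand of
`W ⊗ ℂ = ⊕_σ ∧⁴ H¹_σ`. [cite: Markman2025SecantRealMultiplication, §1.1 ("`∧^d_K H¹(A,ℚ)` is an e-dimensional
subspace HW(A,η)")] -/
def weilSet (ε : Bool × Bool × Bool) (i : ZMod 4) : Finset Line := univ.filter fun L => charK1 ε L = i

set_option maxRecDepth 8000 in
set_option maxHeartbeats 4000000 in
/-- **The Weil monomial of character `σ_i` shadows EXACTLY the exceptional Pohlmann set `E_i` of `Y`** (for the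
conjugate Weil structure: `E_{i+2}`); each has two holomorphic lines among four (type `(2,2)`), and the two
`X₁`-lines of character `i` shadow the adjacent pair `{(1,i),(1,i+1)}` of `S₂` (so `∧²_{K₁}H¹(X₁)` has the
characters of `T(S₂)`). [cite: GaoUllmo2025, Thm 3.1] -/
theorem weilSet_shadow :
    (∀ i : ZMod 4, (weilSet (false, false, false) i).image shadow = excFamily i ∧
      ((weilSet (false, false, false) i).filter fun L => isHol L = true).card = 2 ∧
      (weilSet (true, true, true) i).image shadow = excFamily (i + 2)) ∧
    (∀ i : ZMod 4, (((univ : Finset G).filter fun g => actK1 g 0 = i).image fun g => shadow (.x1 g)) =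
      ({((1 : Fin 3), i), (1, i + 1)} : Finset Pt)) := by
  decide +kernel

set_option maxRecDepth 8000 in
set_option maxHeartbeats 4000000 in
/-- … and the `E_i` are exactly the four exceptional (non-`c`-stable) Pohlmann `4`-sets of `Y`, of Künneth
multidegree `(1,2,1)` (restated from the first two files for the reader of this one). [cite: GaoUllmo2025, Thm 3.1] -/
theorem excFamily_exceptional :
    univ.image excFamily = exceptional ∧ (∀ i : ZMod 4, excFamily i ∈ hodgeSets ∧ cStable (excFamily i) = false ∧
      mdeg (excFamily i) = (1, 2, 1)) := by
  refine ⟨exceptional_eq_image_excFamily.symm, ?_⟩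
  decide +kernel

/-! ## §4 Pohlmann characters: `D ≅ T(S₂)` and `E_i = D_i ⊔ T_i` -/

/-- The Pohlmann character of a set of points: `g ↦ |g·P ∩ Φ|` (the weight of the monomial `e_P` under the CM torus
after twisting by `g`; `e_P` is a Hodge class iff this is the constant `|P|/2`). [cite: GaoUllmo2025, Thm 3.1 eq. (3.2)] -/
def chiSet (P : Finset Pt) (g : G) : ℕ := (P.filter fun x => act g.1 g.2 x ∈ phi).card

/-- The `K₁`-diagonal piece `D ⊂ H¹(S₁) ⊗ H¹(S₁′)`: lines `D_i = {(0,i),(2,i)}`. [folklore] -/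
def dLine (i : ZMod 4) : Finset Pt := {((0 : Fin 3), i), (2, i)}

/-- The transcendental lattice `T(S₂) = ∧²H¹(S₂) ⊖ NS`: lines `T_i = {(1,i),(1,i+1)}` (adjacent pairs; the
conjugate pairs `{(1,i),(1,i+2)}` are `NS(S₂)`). [folklore] -/
def tLine (i : ZMod 4) : Finset Pt := {((1 : Fin 3), i), (1, i + 1)}

set_option maxRecDepth 8000 in
set_option maxHeartbeats 4000000 in
/-- **`E_i = D_i ⊔ T_i`; `D` and `T(S₂)` are K3-type (holomorphic counts `1,2,1,0` resp. `1,0,1,2` along `i`, i.e.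
types `(1,1),(2,0),(1,1),(0,2)` and `(1,1),(0,2),(1,1),(2,0)`) with the SAME character table up to `i ↦ i + 2`;
`E_i` is Hodge because `χ(D_i) + χ(T_i) ≡ 2`.** [cite: GaoUllmo2025, Thm 3.1] -/
theorem characters :
    (∀ i : ZMod 4, excFamily i = dLine i ∪ tLine i ∧ Disjoint (dLine i) (tLine i)) ∧
    ([0, 1, 2, 3].map fun i => chiSet (dLine (i : ZMod 4)) (0, false)) = [1, 2, 1, 0] ∧
    ([0, 1, 2, 3].map fun i => chiSet (tLine (i : ZMod 4)) (0, false)) = [1, 0, 1, 2] ∧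
    (∀ i : ZMod 4, ∀ g : G, chiSet (dLine i) g = chiSet (tLine (i + 2)) g) ∧
    (∀ i : ZMod 4, ∀ g : G, chiSet (dLine i) g + chiSet (tLine i) g = 2) ∧
    (∀ i j : ZMod 4, (∀ g : G, chiSet (dLine i) g + chiSet (tLine j) g = 2) ↔ j = i) := by
  decide +kernel

end WeilLine

end Summit.HodgeConjecture.CorCM.Census.DihedralSurfaceTriple
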